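import Literature.Computability.AlgebraicComplexity.OrbitCoordinateRing
import Literature.NumberTheory.DiophantineGeometry.GLHighestWeight
import Literature.Barriers.ValiantsHypothesis.GKSS17NaturalProofsPIT
import HarnessLib

/-!
# van den Berg–Dutta–Gesmundo–Ikenmeyer–Lysikov 2024: isotypic algebraic natural proofs

M. van den Berg, P. Dutta, F. Gesmundo, C. Ikenmeyer, V. Lysikov, *Algebraic metacomplexity and
representation theory*, arXiv:2411.03444 (2024) [BergEtAl2024]. Typed here (statements only,
named facts per D-0014; support file for the `ValiantsHypothesis` barrier corpus, V4 ↔ V3):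

* §2.5 **Def. 2.3** (algebraic natural proofs for a class `C` cut out by an invariant complexity
  measure, in the `metaVQP` sense), the vanishing ideal `I(C)` of a class, `metaVP` / `metaVQP`,
  and **Thm. 2.4**: "`C` has algebraic natural proofs iff `I(C) ∩ metaVQP ∩ Isotypic` contains a
  sequence that is not eventually zero" (`thm_2_4`);
* **Thm. 1.1 (1)–(3)** (weight-space, isotypic and highest-weight projections of a metapolynomial
  of circuit size `s` have circuits of size `O(s (δd)^{2k³})`, `O(s k^{2k²} (δd)^{2k³})`,
  `O(s (k+1)^{2k²} (δd)^{2k³})`) and **Cor. 1.2** (all metapolynomials of an irreducible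
  `GL_k`-representation have the same circuit complexity up to `O(k^{2k²}(δd)^{2k⁴+k²})`), which
  answers Open Question 2 of [GKSS17] (`GKSS2017.easiestComplexity` in `GKSS17NaturalProofsPIT`).
  Item (4) of Thm. 1.1 (`T`-isotypic spaces, Gelfand–Tsetlin) is NOT typed (deferred).

## Dictionary (tree notions reused)

* A *metapolynomial of format `(δ, d, k)`* — a homogeneous degree-`δ` polynomial on
  `ℂ[x₁,…,x_k]_d`, i.e. an element of `ℂ[c_μ : μ ∈ ℕ^k, |μ| = d]_δ` (p.5, Claim 4.2) — is a
  `Δ : MvPolynomial (DegIdx (Fin k) d) ℂ` with `Δ.IsHomogeneous δ`; `DegIdx`/`degMonomials` and the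
  coefficient point `formCoeff d f` of a form `f` are the tree's (`OrbitCoordinateRing`), so
  `Δ(f) = eval (formCoeff d f) Δ`.
* The `GL_k`-action on metapolynomials, "`(gΔ)(x) = Δ(g⁻¹x)`" (proof of Thm. 2.4, p.11), is the
  tree's `coordRep (Fin k) ℂ d` (same formula). The Lie-algebra form of the action (Claims 4.1–4.2)
  is not typed; the group form suffices for every statement below.
* Weight spaces and highest-weight vectors are the tree's `weightSpace` / `highestWeightSpace`
  (`GLHighestWeight`, upper-triangular Borel, `Weight (Fin k) = Fin k → ℤ`). CONVENTION NOTE: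
  `coordRep` is the dual (function) action, so the diagonal torus acts on the metavariable `c_μ`
  by `t^{-μ}` (pinned in the tree by `coordSubst_monomial_of_isDiagonalGL` / `monWeight_nonpos` of
  `OrbitClosureWeights`: metamonomials are torus weight vectors of weight `monWeight s ≤ 0`); the
  paper's weights (Claim 4.2: `E_{ii}.c_μ = μ_i c_μ`, weights in `ℕ^k`) are the negatives, and its
  Borel is the opposite one. The statements below quantify over ALL weights
  `χ : Weight (Fin k)` and isotypic components are Borel-independent, so no sign enters.
* "Invariant complexity measure" (§2.1, p.7) uses the tree's `linSubstRep` (`LinSubst`).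
* `IsPBounded` (Bürgisser), `GKSS2017.IsPBoundedIn N` ("polynomial in `N(n)`") are reused.

## New definitions (all with bodies; no projection operator is assumed)

* `affComplexity` — circuit size where input gates may carry affine linear forms for free (the
  paper's `cc`, §2.1 p.7: "in the definition of algebraic circuits we allow affine linear forms at
  the input gates", which is what makes `cc` `GL`-invariant; the tree's `complexity` is not).
* `hwSubrep ρ χ` — the subrepresentation generated by the highest-weight vectors of weight `χ`;
  for a completely reducible rational representation in characteristic `0` this IS the isotypic
  component of type `χ` (each irreducible constituent is generated by its highest-weight line;
  Goodman–Wallach §4.1.6 / Fulton–Harris §15.3), which is how "isotypic" is read here;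
  `IsIsotypic Δ` — `Δ` lies in one `hwSubrep`. "The projection of `Δ` onto" a weight space /
  isotypic component / highest-weight space is typed by its CHARACTERISATION (`Δ'` in the target
  space, `Δ - Δ'` in the canonical complement), not by an assumed operator.
* `slice c k d r = X_{d,r}`, `vanishingIdealSeq c kk = I(C)` (p.10–11), `IsQPBoundedIn`, `metaVP`,
  `metaVQP` (p.10), `EventuallyZero`, `HasAlgebraicNaturalProofs` (Def. 2.3).

Circuit-model note: the printed `O(·)` bounds are for the paper's size measure; they are typed
with `affComplexity` on both sides and an existential absolute constant.

Page convention: `p.N` in the `[cite]` tags is the PRINTED page, `(PDF p.M)` / the locators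
`pMMMM.txt:Ln` refer to the PDF pages of `paper:arxiv-2411.03444` (printed = PDF − 1). Statements only; nothing
here bears on the truth of `VP ≠ VNP`.
-/

noncomputable section

open MvPolynomial

namespace Literature.Barriers.ValiantsHypothesis

namespace BergEtAl2024

open Literature.Computability.AlgebraicComplexity Literature.NumberTheory.DiophantineGeometry

/-! ### Circuit size with affine-linear input gates -/

/-- **The paper's circuit size `cc`** (§2.1): algebraic circuits "allow affine linear forms at the
input gates" — so `cc(F)` is the least fan-in-two gate count (`complexity`) of a polynomial `G`
from which `F` is obtained by substituting affine linear forms for the variables. This makes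
`cc(g · f) = cc(f)` for `g ∈ GL_k` ("an invariant complexity measure"). `sInf` of a set of naturals
(attained; `affComplexity_le_complexity`).
[cite: BergEtAl2024, §2.1, p.6 (PDF p.7)] locator: paper:arxiv-2411.03444 p0007.txt:L17–L23 -/
def affComplexity {τ : Type*} (F : MvPolynomial τ ℂ) : ℕ :=
  sInf {s | ∃ (m : ℕ) (G : MvPolynomial (Fin m) ℂ) (ℓ : Fin m → MvPolynomial τ ℂ),
    (∀ i, (ℓ i).totalDegree ≤ 1) ∧ aeval ℓ G = F ∧ complexity G = s}

/-- `cc(F) ≤` the tree's gate count of `F` (substitute the variables themselves).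
[cite: BergEtAl2024, §2.1, p.6 (PDF p.7)] locator: paper:arxiv-2411.03444 p0007.txt:L20–L23 -/
theorem affComplexity_le_complexity {τ : Type*} [Fintype τ] (F : MvPolynomial τ ℂ) :
    affComplexity F ≤ complexity F := by
  classical
  refine Nat.sInf_le ⟨Fintype.card τ, renameEquiv ℂ (Fintype.equivFin τ) F,
    fun i => X ((Fintype.equivFin τ).symm i), fun i => (totalDegree_X _).le, ?_,
    complexity_renameEquiv_holds _ _⟩
  rw [renameEquiv_apply, aeval_rename]
  have : ((fun i => X ((Fintype.equivFin τ).symm i)) ∘ (Fintype.equivFin τ) :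
      τ → MvPolynomial τ ℂ) = X := by
    funext i; simp
  rw [this, aeval_X_left, AlgHom.coe_id, id_eq]

/-! ### Invariant complexity measures and the slices `X_{d,r}` -/

/-- **An invariant complexity measure** (§2.1): a complexity `c(f) ∈ ℕ` of homogeneous
polynomials (`c k d f` for `f ∈ ℂ[x₁,…,x_k]_d`; values on non-forms are irrelevant) with
`c(g · f) = c(f)` for every `g ∈ GL_k` — e.g. `cc`, formula size, ABP width, permanental
complexity (with affine-linear inputs).
[cite: BergEtAl2024, §2.1, p.6 (PDF p.7)] locator: paper:arxiv-2411.03444 p0007.txt:L17–L39 -/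
def IsInvariantMeasure (c : (k d : ℕ) → MvPolynomial (Fin k) ℂ → ℕ) : Prop :=
  ∀ (k d : ℕ) (g : GL (Fin k) ℂ) (f : MvPolynomial (Fin k) ℂ), f.IsHomogeneous d →
    c k d (linSubstRep (Fin k) ℂ g f) = c k d f

/-- **`X_{d,r}`** (§2.5): "the set of homogeneous degree `d` polynomials `f` with `c(f) ≤ r`"
(in `k` variables). [cite: BergEtAl2024, §2.5, p.9 (PDF p.10)] locator: paper:arxiv-2411.03444 p0010.txt:L61–L62 -/
def slice (c : (k d : ℕ) → MvPolynomial (Fin k) ℂ → ℕ) (k d r : ℕ) :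
    Set (MvPolynomial (Fin k) ℂ) :=
  {f | f.IsHomogeneous d ∧ c k d f ≤ r}

/-! ### Sequences of metapolynomials of format `(δ(n), n, k(n))` -/

/-- "Quasipolynomially bounded in `N(n)`": `t n ≤ 2^{(log₂ N(n) + a)^a}` for a constant `a` (the
tree's `IsQPBounded` with `n` replaced by `N n`; cf. `GKSS2017.IsPBoundedIn`).
[cite: BergEtAl2024, §2.5 (definition of metaVQP), p.9 (PDF p.10)] locator: paper:arxiv-2411.03444 p0010.txt:L32–L33 -/
def IsQPBoundedIn (N t : ℕ → ℕ) : Prop :=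
  ∃ a : ℕ, ∀ n, t n ≤ 2 ^ ((Nat.log 2 (N n) + a) ^ a)

/-- `N(n) = binom(k(n) + n - 1, n)`, "the number of degree `n` monomials in `k` variables".
[cite: BergEtAl2024, §2.5, p.9 (PDF p.10)] locator: paper:arxiv-2411.03444 p0010.txt:L30–L32 -/
def numMonomials (kk : ℕ → ℕ) (n : ℕ) : ℕ :=
  (kk n + n - 1).choose n

/-- **`metaVP`** (§2.5, following [GKSS17]): sequences `(Δ_n)` of metapolynomials of format
`(δ(n), n, k(n))` with `k(n)` polynomially bounded in `n`, and `δ(n)` and `cc(Δ_n)` polynomially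
bounded in `N(n)`. [cite: BergEtAl2024, §2.5, p.9 (PDF p.10)] locator: paper:arxiv-2411.03444 p0010.txt:L29–L32 -/
def metaVP (kk : ℕ → ℕ) : Set ((n : ℕ) → MvPolynomial (DegIdx (Fin (kk n)) n) ℂ) :=
  {Δ | IsPBounded kk ∧ ∃ δ : ℕ → ℕ, (∀ n, (Δ n).IsHomogeneous (δ n)) ∧
    GKSS2017.IsPBoundedIn (numMonomials kk) δ ∧
    GKSS2017.IsPBoundedIn (numMonomials kk) fun n => affComplexity (Δ n)}

/-- **`metaVQP`** (§2.5): "defined analogously, but with `cc(Δ_n)` quasipolynomially bounded in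
`N(n)`". [cite: BergEtAl2024, §2.5, p.9 (PDF p.10)] locator: paper:arxiv-2411.03444 p0010.txt:L32–L33 -/
def metaVQP (kk : ℕ → ℕ) : Set ((n : ℕ) → MvPolynomial (DegIdx (Fin (kk n)) n) ℂ) :=
  {Δ | IsPBounded kk ∧ ∃ δ : ℕ → ℕ, (∀ n, (Δ n).IsHomogeneous (δ n)) ∧
    GKSS2017.IsPBoundedIn (numMonomials kk) δ ∧
    IsQPBoundedIn (numMonomials kk) fun n => affComplexity (Δ n)}

/-- **The vanishing ideal `I(C)` of the class `C` of p-families with polynomially bounded `c`**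
(§2.5): the sequences `(Δ_n)` of format `(∗, n, ∗)` such that "for every polynomially bounded
`r(n)`, the sequence `(Δ_1|_{X_{1,r(1)}}, Δ_2|_{X_{2,r(2)}}, …)` eventually vanishes identically".
[cite: BergEtAl2024, §2.5 (definition of I(C)), p.9–10 (PDF p.10–11)] locator: paper:arxiv-2411.03444 p0011.txt:L1–L8 -/
def vanishingIdealSeq (c : (k d : ℕ) → MvPolynomial (Fin k) ℂ → ℕ) (kk : ℕ → ℕ) :
    Set ((n : ℕ) → MvPolynomial (DegIdx (Fin (kk n)) n) ℂ) :=
  {Δ | ∀ r : ℕ → ℕ, IsPBounded r → ∃ n₀ : ℕ, ∀ n, n₀ ≤ n →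
    ∀ f ∈ slice c (kk n) n (r n), eval (formCoeff n f) (Δ n) = 0}

/-- A sequence is *eventually zero*. [cite: BergEtAl2024, Def. 2.3, p.10 (PDF p.11)] locator: paper:arxiv-2411.03444 p0011.txt:L21–L22 -/
def EventuallyZero {kk : ℕ → ℕ} (Δ : (n : ℕ) → MvPolynomial (DegIdx (Fin (kk n)) n) ℂ) : Prop :=
  ∃ n₀ : ℕ, ∀ n, n₀ ≤ n → Δ n = 0

/-- **Definition 2.3 (Algebraic natural proof).** "We say that `C` has algebraic natural proofs if
`I(C) ∩ metaVQP` contains a sequence that is not eventually zero" ("Here we loosened the standard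
definition slightly from `metaVP` (see [GKSS17, CKR+20]) to `metaVQP`"). `C` is the class cut out
by the invariant measure `c`; the format's `k(n)` is part of the witness.
[cite: BergEtAl2024, Def. 2.3, p.10 (PDF p.11)] locator: paper:arxiv-2411.03444 p0011.txt:L21–L24 -/
def HasAlgebraicNaturalProofs (c : (k d : ℕ) → MvPolynomial (Fin k) ℂ → ℕ) : Prop :=
  ∃ (kk : ℕ → ℕ) (Δ : (n : ℕ) → MvPolynomial (DegIdx (Fin (kk n)) n) ℂ),
    Δ ∈ vanishingIdealSeq c kk ∧ Δ ∈ metaVQP kk ∧ ¬ EventuallyZero Δ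

/-! ### Isotypic metapolynomials -/

section Isotypic

variable {σ K V : Type*} [Fintype σ] [LinearOrder σ] [Field K] [AddCommGroup V] [Module K V]

/-- **The subrepresentation generated by the highest-weight vectors of weight `χ`**: the linear
span of `{ρ(g) v : g ∈ GL, v a highest-weight vector of weight χ}`. For a completely reducible
rational representation of `GL_k(ℂ)` this is the isotypic component of type `χ` (every
irreducible constituent of highest weight `χ` is generated by its highest-weight line, and has no
other highest weight) — the reading of "the `λ`-isotypic component" used in this file
(Goodman–Wallach §4.1.6; Fulton–Harris §15.3; the paper's §4).
[cite: BergEtAl2024, §1 ("isotypic component", p.4–5) and §2.5 proof of Thm. 2.4, p.10 (PDF p.11)] locator: paper:arxiv-2411.03444 p0011.txt:L43–L50 -/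
def hwSubrep (ρ : Representation K (GL σ K) V) (χ : Weight σ) : Submodule K V :=
  Submodule.span K {w | ∃ g : GL σ K, ∃ v ∈ highestWeightSpace ρ χ, w = ρ g v}

/-- Highest-weight vectors of weight `χ` lie in `hwSubrep ρ χ` (`g = 1`).
[cite: BergEtAl2024, §2.5, p.10 (PDF p.11)] locator: paper:arxiv-2411.03444 p0011.txt:L43–L50 -/
theorem highestWeightSpace_le_hwSubrep (ρ : Representation K (GL σ K) V) (χ : Weight σ) :
    highestWeightSpace ρ χ ≤ hwSubrep ρ χ :=
  fun v hv => Submodule.subset_span ⟨1, v, hv, by simp⟩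

/-- `hwSubrep ρ χ` is stable under the group ("`I(X)_δ` … closed under the action"), i.e. a
subrepresentation. [cite: BergEtAl2024, §2.5 proof of Thm. 2.4, p.10 (PDF p.11)] locator: paper:arxiv-2411.03444 p0011.txt:L44–L47 -/
theorem map_hwSubrep_le (ρ : Representation K (GL σ K) V) (χ : Weight σ) (g : GL σ K) :
    (hwSubrep ρ χ).map (ρ g) ≤ hwSubrep ρ χ := by
  rw [hwSubrep, Submodule.map_span_le]
  rintro _ ⟨h, v, hv, rfl⟩
  exact Submodule.subset_span ⟨g * h, v, hv, by rw [map_mul]; rfl⟩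

end Isotypic

/-- The isotypic components `hwSubrep (coordRep) χ` are test `GL_k`-modules in the sense of
[GKSS17] §4.1 (`GKSS2017.IsTestModule`: `G`-stable subspaces of metapolynomials) — the link to
GKSS Open Question 2 answered by Cor. 1.2. [cite: BergEtAl2024, §1 (after Thm. 1.1), p.5 (PDF p.6)] locator: paper:arxiv-2411.03444 p0006.txt:L1–L6 -/
theorem isTestModule_hwSubrep (d k : ℕ) (χ : Weight (Fin k)) :
    GKSS2017.IsTestModule (coordRep (Fin k) ℂ d) (hwSubrep (coordRep (Fin k) ℂ d) χ) :=
  fun g _ hT => map_hwSubrep_le _ χ g (Submodule.mem_map_of_mem hT)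

/-- **Isotypic metapolynomials** (§2.5: "Let Isotypic denote the set of sequences of isotypic
metapolynomials"): `Δ` of format `(δ, d, k)` is *isotypic* if it lies in a single isotypic
component of the `GL_k`-representation on metapolynomials, i.e. in `hwSubrep (coordRep) χ` for
some weight `χ` (`0` is isotypic).
[cite: BergEtAl2024, §2.5 (before Thm. 2.4), p.10 (PDF p.11)] locator: paper:arxiv-2411.03444 p0011.txt:L36–L39 -/
def IsIsotypic {d k : ℕ} (Δ : MvPolynomial (DegIdx (Fin k) d) ℂ) : Prop :=
  ∃ χ : Weight (Fin k), Δ ∈ hwSubrep (coordRep (Fin k) ℂ d) χ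

/-- **Theorem 2.4 (Main theorem about algebraic natural proofs).** For the class `C` cut out by an
invariant complexity measure `c`: "`C` has algebraic natural proofs if and only if
`I(C) ∩ metaVQP ∩ Isotypic` contains a sequence that is not eventually zero." (Proof: one
direction is an inclusion; the other projects a witness onto a nonzero isotypic component, which
stays in `I(C)` because each `X_{n,i}` is `GL`-invariant, and stays in `metaVQP` by Thm. 1.1 with
`k(n) ≤ poly(log N)`.) Named fact (D-0014).
[cite: BergEtAl2024, Thm. 2.4, p.10 (PDF p.11)] locator: paper:arxiv-2411.03444 p0011.txt:L40–L41 (proof L42–p0012.txt:L12) -/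
def thm_2_4 : Prop :=
  ∀ c : (k d : ℕ) → MvPolynomial (Fin k) ℂ → ℕ, IsInvariantMeasure c →
    (HasAlgebraicNaturalProofs c ↔
      ∃ (kk : ℕ → ℕ) (Δ : (n : ℕ) → MvPolynomial (DegIdx (Fin (kk n)) n) ℂ),
        Δ ∈ vanishingIdealSeq c kk ∧ Δ ∈ metaVQP kk ∧ (∀ n, IsIsotypic (Δ n)) ∧
          ¬ EventuallyZero Δ)

/-- The easy direction of Thm. 2.4 ("One direction is clear, because
`I(C) ∩ metaVQP ∩ Isotypic ⊆ I(C) ∩ metaVQP`"), proved.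
[cite: BergEtAl2024, Thm. 2.4 (proof, first sentence), p.10 (PDF p.11)] locator: paper:arxiv-2411.03444 p0011.txt:L42 -/
theorem thm_2_4_mpr (c : (k d : ℕ) → MvPolynomial (Fin k) ℂ → ℕ)
    (h : ∃ (kk : ℕ → ℕ) (Δ : (n : ℕ) → MvPolynomial (DegIdx (Fin (kk n)) n) ℂ),
      Δ ∈ vanishingIdealSeq c kk ∧ Δ ∈ metaVQP kk ∧ (∀ n, IsIsotypic (Δ n)) ∧ ¬ EventuallyZero Δ) :
    HasAlgebraicNaturalProofs c :=
  let ⟨kk, Δ, h1, h2, _, h4⟩ := h; ⟨kk, Δ, h1, h2, h4⟩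

/-! ### Theorem 1.1: complexity of the projections -/

/-- **Theorem 1.1 (1) (weight spaces).** "Let `Δ : ℂ[x₁,…,x_k]_d → ℂ` be a metapolynomial of
format `(δ, d, k)` computed by an algebraic circuit of size `s`. Then for every weight `μ`,
`|μ| = dδ`, the projection of `Δ` onto the weight space of weight `μ` can be computed by a circuit
of size `O(s (δd)^{2k³})`." Typed for every weight `χ` of the diagonal torus (for a weight that
does not occur the projection is `0`), the projection `Δ'` being characterised by
`Δ' ∈ V_χ`, `Δ - Δ' ∈ ⨆_{χ' ≠ χ} V_{χ'}`; absolute constant existential. Degenerate format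
`d = 0` excluded (`1 ≤ d`): the print's `O(·)` is asymptotic and is read with `d ≥ 1` — at `d = 0`
the explicit bound `C·s·(δd)^{…} = 0` would be refutable (val-lit referee row np/123). Named fact (D-0014).
[cite: BergEtAl2024, Thm. 1.1 (1), p.4 (PDF p.5)] locator: paper:arxiv-2411.03444 p0005.txt:L70–L76 -/
def thm_1_1_weight : Prop :=
  ∃ C : ℕ, ∀ (δ d k s : ℕ) (Δ : MvPolynomial (DegIdx (Fin k) d) ℂ), 1 ≤ d → Δ.IsHomogeneous δ →
    affComplexity Δ ≤ s → ∀ χ : Weight (Fin k),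
      ∃ Δ' : MvPolynomial (DegIdx (Fin k) d) ℂ,
        Δ' ∈ weightSpace (coordRep (Fin k) ℂ d) χ ∧
        Δ - Δ' ∈ ⨆ χ' ∈ {χ' : Weight (Fin k) | χ' ≠ χ}, weightSpace (coordRep (Fin k) ℂ d) χ' ∧
        affComplexity Δ' ≤ C * s * (δ * d) ^ (2 * k ^ 3)

/-- **Theorem 1.1 (2) (isotypic components).** "For every partition `λ ⊢ dδ` the projection of `Δ`
onto the `λ`-isotypic component can be computed by a circuit of size `O(s k^{2k²} (δd)^{2k³})`."
Typed for every weight `χ` (non-occurring types have projection `0`), `Δ'` characterised by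
`Δ' ∈ hwSubrep χ` and `Δ - Δ' ∈ ⨆_{χ' ≠ χ} hwSubrep χ'`. Degenerate format
`d = 0` excluded (`1 ≤ d`): the print's `O(·)` is asymptotic and is read with `d ≥ 1` — at `d = 0`
the explicit bound `C·s·(δd)^{…} = 0` would be refutable (val-lit referee row np/123). Named fact (D-0014).
[cite: BergEtAl2024, Thm. 1.1 (2), p.4 (PDF p.5)] locator: paper:arxiv-2411.03444 p0005.txt:L77–L79 -/
def thm_1_1_isotypic : Prop :=
  ∃ C : ℕ, ∀ (δ d k s : ℕ) (Δ : MvPolynomial (DegIdx (Fin k) d) ℂ), 1 ≤ d → Δ.IsHomogeneous δ →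
    affComplexity Δ ≤ s → ∀ χ : Weight (Fin k),
      ∃ Δ' : MvPolynomial (DegIdx (Fin k) d) ℂ,
        Δ' ∈ hwSubrep (coordRep (Fin k) ℂ d) χ ∧
        Δ - Δ' ∈ ⨆ χ' ∈ {χ' : Weight (Fin k) | χ' ≠ χ}, hwSubrep (coordRep (Fin k) ℂ d) χ' ∧
        affComplexity Δ' ≤ C * s * k ^ (2 * k ^ 2) * (δ * d) ^ (2 * k ^ 3)

/-- **Theorem 1.1 (3) (highest weight spaces).** "For every partition `λ ⊢ dδ` the projection of
`Δ` onto the highest weight space of weight `λ` can be computed by a circuit of size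
`O(s (k+1)^{2k²} (δd)^{2k³})`." The highest-weight space of weight `χ` is the weight-`χ` part of
the `χ`-isotypic component; `Δ'` is characterised by `Δ' ∈ highestWeightSpace χ` and
`Δ - Δ' ∈ (⨆_{χ' ≠ χ} hwSubrep χ') ⊔ (⨆_{χ' ≠ χ} V_{χ'})`. Degenerate format
`d = 0` excluded (`1 ≤ d`): the print's `O(·)` is asymptotic and is read with `d ≥ 1` — at `d = 0`
the explicit bound `C·s·(δd)^{…} = 0` would be refutable (val-lit referee row np/123). Named fact (D-0014).
[cite: BergEtAl2024, Thm. 1.1 (3), p.4 (PDF p.5)] locator: paper:arxiv-2411.03444 p0005.txt:L80–L81 -/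
def thm_1_1_hwv : Prop :=
  ∃ C : ℕ, ∀ (δ d k s : ℕ) (Δ : MvPolynomial (DegIdx (Fin k) d) ℂ), 1 ≤ d → Δ.IsHomogeneous δ →
    affComplexity Δ ≤ s → ∀ χ : Weight (Fin k),
      ∃ Δ' : MvPolynomial (DegIdx (Fin k) d) ℂ,
        Δ' ∈ highestWeightSpace (coordRep (Fin k) ℂ d) χ ∧
        Δ - Δ' ∈ (⨆ χ' ∈ {χ' : Weight (Fin k) | χ' ≠ χ}, hwSubrep (coordRep (Fin k) ℂ d) χ') ⊔
          (⨆ χ' ∈ {χ' : Weight (Fin k) | χ' ≠ χ}, weightSpace (coordRep (Fin k) ℂ d) χ') ∧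
        affComplexity Δ' ≤ C * s * (k + 1) ^ (2 * k ^ 2) * (δ * d) ^ (2 * k ^ 3)

/-- **Corollary 1.2.** "Let `s` be the smallest circuit complexity of a nonzero metapolynomial in
an irreducible `GL_k`-representation `V` of type `λ ⊢ δd`. Then every metapolynomial in `V` has
circuit complexity at most `O(s k^{2k²} (δd)^{2k⁴+k²})`." (`V` a `GL_k`-stable irreducible
subspace of format-`(δ,d,k)` metapolynomials; this answers [GKSS17] Open Question 2, cf.
`GKSS2017.easiestComplexity`.) Degenerate format
`d = 0` excluded (`1 ≤ d`): the print's `O(·)` is asymptotic and is read with `d ≥ 1` — at `d = 0`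
the explicit bound `C·s·(δd)^{…} = 0` would be refutable (val-lit referee row np/123). Named fact (D-0014).
[cite: BergEtAl2024, Cor. 1.2, p.5 (PDF p.6)] locator: paper:arxiv-2411.03444 p0006.txt:L7–L10 -/
def cor_1_2 : Prop :=
  ∃ C : ℕ, ∀ (δ d k : ℕ), 1 ≤ d → ∀ (W : Submodule ℂ (MvPolynomial (DegIdx (Fin k) d) ℂ))
    (hW : ∀ g : GL (Fin k) ℂ, W ≤ W.comap (coordRep (Fin k) ℂ d g)),
    ((coordRep (Fin k) ℂ d).subrepresentation W hW).IsIrreducible →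
    (∀ Δ ∈ W, Δ.IsHomogeneous δ) →
    ∀ (s : ℕ) (Δ₀ : MvPolynomial (DegIdx (Fin k) d) ℂ), Δ₀ ∈ W → Δ₀ ≠ 0 → affComplexity Δ₀ = s →
      (∀ Δ ∈ W, Δ ≠ 0 → s ≤ affComplexity Δ) →
      ∀ Δ ∈ W, affComplexity Δ ≤ C * s * k ^ (2 * k ^ 2) * (δ * d) ^ (2 * k ^ 4 + k ^ 2)


/-! ### `cc` is an invariant complexity measure (§2.1, proved) -/

section Invariance

/-- Substituting polynomials of degree `≤ 1` does not raise the total degree. [folklore] -/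
private theorem totalDegree_aeval_le_of_le_one {σ τ : Type*} (ℓ : σ → MvPolynomial τ ℂ)
    (hℓ : ∀ i, (ℓ i).totalDegree ≤ 1) (p : MvPolynomial σ ℂ) :
    (aeval ℓ p).totalDegree ≤ p.totalDegree := by
  classical
  conv_lhs => rw [p.as_sum]
  rw [map_sum]
  refine totalDegree_finsetSum_le fun m hm => ?_
  rw [aeval_monomial, Finsupp.prod]
  calc (algebraMap ℂ (MvPolynomial τ ℂ) (coeff m p) * ∏ i ∈ m.support, ℓ i ^ m i).totalDegree
      ≤ (algebraMap ℂ (MvPolynomial τ ℂ) (coeff m p)).totalDegree +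
          (∏ i ∈ m.support, ℓ i ^ m i).totalDegree := totalDegree_mul _ _
    _ ≤ 0 + ∑ i ∈ m.support, (ℓ i ^ m i).totalDegree := by
        gcongr
        · exact (totalDegree_C _).le
        · exact totalDegree_finsetProd _ _
    _ ≤ 0 + ∑ i ∈ m.support, m i := by
        gcongr with i hi
        exact (totalDegree_pow _ _).trans (by simpa using Nat.mul_le_mul_left (m i) (hℓ i))
    _ = m.sum fun _ e => e := by rw [zero_add, Finsupp.sum]
    _ ≤ p.totalDegree := le_totalDegree hm

/-- **`cc` does not increase under linear substitutions** ("a circuit for `g · f` is obtained from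
the one for `f` by applying `g` at the input gates"): `cc(A · F) ≤ cc(F)` for every square matrix
`A`, in the tree's `affComplexity` model. [cite: BergEtAl2024, §2.1, p.6 (PDF p.7)] locator: paper:arxiv-2411.03444 p0007.txt:L17–L20 -/
theorem affComplexity_linSubst_le {k : ℕ} (A : Matrix (Fin k) (Fin k) ℂ) (F : MvPolynomial (Fin k) ℂ) :
    affComplexity (linSubst (Fin k) ℂ A F) ≤ affComplexity F := by
  classical
  -- a witness of `cc(F)`
  have hne : {s | ∃ (m : ℕ) (G : MvPolynomial (Fin m) ℂ) (ℓ : Fin m → MvPolynomial (Fin k) ℂ),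
      (∀ i, (ℓ i).totalDegree ≤ 1) ∧ aeval ℓ G = F ∧ complexity G = s}.Nonempty :=
    ⟨complexity F, k, F, X, fun i => (totalDegree_X _).le, by
        rw [aeval_X_left, AlgHom.coe_id, id_eq], rfl⟩
  obtain ⟨m, G, ℓ, hℓ, hG, hc⟩ := Nat.sInf_mem hne
  -- compose the affine inputs with `A`
  refine Nat.sInf_le ⟨m, G, fun i => linSubst (Fin k) ℂ A (ℓ i), fun i => ?_, ?_, hc⟩
  · unfold linSubst
    refine (totalDegree_aeval_le_of_le_one _ (fun j => ?_) _).trans (hℓ i)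
    refine totalDegree_finsetSum_le fun j' _ => (totalDegree_smul_le _ _).trans (totalDegree_X _).le
  · rw [← hG, ← AlgHom.comp_apply, comp_aeval]

/-- **`cc` is an invariant complexity measure** (§2.1: "`cc(f) = cc(g · f)` for any `g ∈ GL_k` …
We say that the complexity measure `cc` is an invariant complexity measure"), proved for
`affComplexity`: Def. 2.3 / Thm. 2.4 apply to `c = cc`, i.e. to `C = VP` (with affine inputs).
[cite: BergEtAl2024, §2.1, p.6 (PDF p.7)] locator: paper:arxiv-2411.03444 p0007.txt:L17–L21 -/
theorem isInvariantMeasure_affComplexity :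
    IsInvariantMeasure fun _ _ f => affComplexity f := by
  intro k d g f _
  refine le_antisymm (affComplexity_linSubst_le _ _) ?_
  have h := affComplexity_linSubst_le ((g⁻¹ : GL (Fin k) ℂ) : Matrix (Fin k) (Fin k) ℂ)
    (linSubstRep (Fin k) ℂ g f)
  rwa [← linSubstRep_apply, ← Module.End.mul_apply, ← map_mul, inv_mul_cancel, map_one,
    Module.End.one_apply] at h

end Invariance


/-! ### Dictionary to the V3 (GCT) census objects (val-lit lead-bip / lead-np request) -/

/-- **Highest-weight vectors of the orbit vanishing ideal are isotypic equations.** A weight-`χ`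
highest-weight vector `Δ` of the `GL_k`-module of format-`(·, d, k)` metapolynomials that lies in
the vanishing ideal `I(GL_k · f)` (tree: `orbitVanishingIdeal f d`) is an ISOTYPIC metapolynomial
(`IsIsotypic`, via `hwSubrep`) vanishing at every point `g · f` of the orbit — i.e. an isotypic
equation for the orbit (closure) of `f` in the sense of the objects of Def. 2.3 / Thm. 2.4; these
are the vectors counted on the GCT side by occurrence / vanishing-ideal obstructions
(`IsVanishingIdealOccurrenceObstructionAt` in `ObstructionTypes`; the `iff` with
`orbitMultiplicity < plethysmCoeff` is left as a bridging target). §2.3 of the paper ("if `Δ`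
vanishes on `X_r` and `Δ(f_hard) ≠ 0`, then there exists a highest weight vector `Δ'` vanishing on
`X_r` …"). [cite: BergEtAl2024, §2.3, p.8 (PDF p.9)] locator: paper:arxiv-2411.03444 p0009.txt:L1–L7 -/
theorem isIsotypic_of_mem_orbitVanishingIdeal_of_mem_highestWeightSpace {d k : ℕ}
    (f : MvPolynomial (Fin k) ℂ) (χ : Weight (Fin k)) {Δ : MvPolynomial (DegIdx (Fin k) d) ℂ}
    (hI : Δ ∈ orbitVanishingIdeal f d) (hχ : Δ ∈ highestWeightSpace (coordRep (Fin k) ℂ d) χ) :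
    IsIsotypic Δ ∧ ∀ g : GL (Fin k) ℂ, aeval (formCoeff d (linSubstRep (Fin k) ℂ g f)) Δ = 0 :=
  ⟨⟨χ, highestWeightSpace_le_hwSubrep _ χ hχ⟩, mem_orbitVanishingIdeal_iff.1 hI⟩

end BergEtAl2024

end Literature.Barriers.ValiantsHypothesis
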